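import Literature.MathematicalPhysics.QuantumLattice.HubbardTTPrimeGrandCanonicalGibbsMixture
import Literature.MathematicalPhysics.QuantumLattice.HubbardTTPrimeGrandCanonicalTorusLimit
import Literature.MathematicalPhysics.QuantumLattice.TorusLimitOfMixtures
import Literature.MathematicalPhysics.QuantumLattice.PairSourcedTorusLimitResponse
import HarnessLib

/-!
# Thermal grand-canonical states of the 2D `t–t'` Hubbard model: the joint temperature × coupling tangent
# plane for STATES, Griffiths brackets for density / magnetisation / double occupancy / hopping energies /
# thermal energy, and the energy–entropy window

Family `hubbard` (topic `MathematicalPhysics/QuantumLattice`; namespace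
`Literature.MathematicalPhysics.QuantumLattice.InfVolFermionState`). Stage S2 of the Hubbard material oracle
(«certifier families … `T > 0`», D-0096 (ii)/(iii)); the STATE side of the grand-canonical numbers
`P = gcPressureTT'Zeeman β t t' U μ h` (`HubbardTTPrimeGrandCanonicalPressureZeeman`). A **thermal grand-canonical
state** is any torus limit `ω` (`InfVolFermionState.IsTorusLimitOfMixture`, Bratteli–Robinson I §4.3.1: translation
average + weak-⋆ limit along `Ls → ∞`) of the grand-canonical Gibbs states `e^{−βK_L}/tr e^{−βK_L}` of
`K_L = K_L(t,t',U,μ,h) = H_L − μN − hM` written as the eigen-mixtures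
`(sourcedGibbsCount, gcGibbsWeightTT' β t t' U μ h, gcGibbsVectorTT' t t' U μ h)` of
`HubbardTTPrimeGrandCanonicalGibbsMixture`. Writing `ρ(ω)` for the density, `ρ_σ(ω) = Re ω(n_{0σ})`,
`m(ω) = ρ↑(ω) − ρ↓(ω)`, `D(ω) = Re ω(n_{0↑}n_{0↓})`, `K₁(ω) = e_{Φ(1,0,0)}(ω)`, `K₂(ω) = e_{Φ(0,1,0)}(ω)` and
`u_x(ω) = e_{Φ(t,t',U)}(ω) − μρ(ω) − h m(ω)` for the `K(x)`-energy density at `x = (t,t',U,μ,h)`: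

* §1 (ANY mixture torus limit, any weights) the averaged spin numbers, particle number, spin imbalance and
  `K_L(x₁)`-energy per site converge to `ρ_σ(ω)`, `ρ(ω)`, `m(ω)`, `u_{x₁}(ω)`
  (`IsTorusLimitOfMixture.tendsto_sum_mul_re_expect_{spinNumber,totalNumber,spinImbalance}_div`,
  `…_gcTorusHamiltonianTT'_div_sq`).
* §2 **THE JOINT TEMPERATURE × COUPLING TANGENT PLANE FOR THERMAL GRAND-CANONICAL STATES**
  (`IsTorusLimitOfMixture.gcPressureTT'Zeeman_sub_le_of_gcGibbs`): for `ω` thermal at `(β; x)` (`β ≥ 0`, `U ≥ 0`)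
  and every `(β₁; x₁)` with `β₁ ≥ 0`, `U₁ ≥ 0`,

    `P(β; x) − [β₁ u_{x₁}(ω) − β u_x(ω)] ≤ P(β₁; x₁)`

  — the thermodynamic limit of the Peierls–Bogoliubov tangent of `HubbardTTPrimeGrandCanonicalGibbsMixture`
  (`log Re Z/L² → P` on both sides, the mixture averages `→` the slopes of `ω`). Coordinate instances = the
  **Griffiths brackets for the state**: `βρ(ω)(μ₁ − μ) ≤ P(μ₁) − P(μ)`, `βm(ω)(h₁ − h) ≤ P(h₁) − P(h)`,
  `−βD(ω)(U₁ − U) ≤ P(U₁) − P(U)` (`U₁ ≥ 0`), `−βK₂(ω)(t'₁ − t') ≤ P(t'₁) − P(t')`, `−βK₁(ω)(t₁ − t) ≤ P(t₁) − P(t)`,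
  `P(β) − P(β₁) ≤ (β₁ − β)u_x(ω)` — and their CERTIFICATE FORMS: a certified floor at the anchor and two certified
  ceilings at `±δ` in one coordinate bracket that observable of EVERY thermal grand-canonical state at the anchor
  (`density_/magnetisation_/docc_/diagHop_/energy_mem_Icc_of_gc_bounds_of_gcGibbs`): `μ`-keyed grand-canonical
  certificates become density / magnetisation / docc / `K₂` / energy WORDS FOR STATES.
* §2 (end) the **energy–entropy window**: `c ≤ u_x(ω)` from any eventual floor `cL² ≤ E₀(K_L)` (variational, no
  `β`), `u_x(ω) ≤ c + (log 4)/β` from any eventual cap (Gibbs' principle, `S ≤ L² log 4`); at `h = 0` keyed to the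
  `T = 0` grand potential `p₀ = gcEnergyDensityTT'` (`tendsto_groundEnergy_gc_hubbardTorusTT'_div_sq`):
  `p₀(μ) ≤ e_Φ(ω) − μρ(ω) ≤ p₀(μ) + (log 4)/β` — every certified `μ`-floor row on `p₀`
  (`HubbardTTPrimeChemicalPotentialFloors`) is a floor on the thermal energy of the thermal states at `μ`.

Strict interiority `0 < ρ(ω) < 2`, the attained Legendre transform `p(ρ(ω)) + βμρ(ω) = P(μ)` and the explicit
density window are in the companion `HubbardTTPrimeGrandCanonicalThermalStatesEnsembles`. Everything is PROVED;
no definition, no named fact, no sorry. WHAT THIS IS NOT: a KMS / uniqueness statement (the class is "all torus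
limits of the finite-volume Gibbs states"); a number of record; a certificate; a phase word.

## Mathlib / tree search

`lean search 'IsTorusLimitOfMixture.*gcGibbs|IsTorusLimitOfMixture.*gcPressure|IsTorusLimitOfMixture.*spinImbalance'`:
nothing (2026-08-27); the canonical-ensemble analogues are `IsTorusLimitOfMixture.meanEnergy_diagHop_…_of_sectorGibbs`
(`HubbardTTPrimeDiagHopTransportThermal`), `…_onSite_…_of_sectorGibbs` (`HubbardTTPrimeDoccTransportThermal`) and the
canonical chords of `HubbardTTPrimeThermalPressure`; the `T = 0` analogue is `IsTorusLimitOf.gcEnergyDensityTT'_le_tangent`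
(`HubbardTTPrimeGrandCanonicalEnergyDensity`). REUSED: `IsTorusLimitOfMixture.tendsto_meanEnergy_hubbardTTPrime`,
`….meanEnergy_onSite_eq_re_expect_docc`, `….isTranslationInvariant` (`TorusLimitOfMixtures`), `torusAvgExpect_nAt`
(`PairSourcedTorusLimitResponse`), `meanEnergy_hubbardTTPrime_affine/_add/_smul` (`HubbardTTPrimeMeanEnergySupergradient`),
`log_partitionFn_gcTorus_ge_tangent_mixture`, `tendsto_log_partitionFn_gcTorus_div_sq_comp`,
`sum_gcGibbsWeightTT'_mul_re_expect_le_log_four`, `re_expect_gcTorusHamiltonianTT'` (`HubbardTTPrimeGrandCanonicalGibbsMixture`),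
`groundEnergy_le_rayleigh_holds` (`FinDimSpectrumProofs`), `tendsto_groundEnergy_gc_hubbardTorusTT'_div_sq`
(`HubbardTTPrimeGrandCanonicalTorusLimit`).

## References

* R. B. Griffiths, J. Math. Phys. 5 (1964) 1215 (convexity of the free energy; expectation values as
  one-sided derivatives — "Griffiths' lemma"). [cite: Griffiths1964]
* E. H. Lieb, Adv. Math. 11 (1973) 267, §V (5.2)–(5.4) (Peierls–Bogoliubov inequalities). [cite: Lieb1973, §V (5.2)–(5.4)]
* D. Ruelle, *Statistical Mechanics: Rigorous Results* (1969), §3.4 (pressure, density, chemical potential;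
  equivalence of ensembles). [cite: Ruelle1969, §3.4]
* R. B. Israel, *Convexity in the Theory of Lattice Gases* (1979), Lemma II.3.1 (finite-volume variational
  principle), Thm. I.3.4 (convexity / tangent functionals). [cite: Israel1979, Lemma II.3.1]
* O. Bratteli, D. W. Robinson, *Operator Algebras and Quantum Statistical Mechanics I* (1987), §4.3.1
  (group-averaged states, weak-⋆ limit points). [cite: BratteliRobinsonI1987, §4.3.1 (PDF pp. 373–375)]
* O. Bratteli, A. Kishimoto, D. W. Robinson, Commun. Math. Phys. 64 (1978) 41, Thm. 2 (mean energy functional).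
  [cite: BratteliKishimotoRobinson1978, Thm. 2]
* T. Koma, H. Tasaki, J. Stat. Phys. 76 (1994) 745, §1 (conjugate observables as slopes). [cite: KomaTasaki1994, §1]
* H. Tasaki, *Physics and Mathematics of Quantum Many-Body Systems* (2020), §2.1 (variational characterisation
  of the ground-state energy). [cite: Tasaki2020, §2.1]
* E. H. Lieb, Phys. Rev. Lett. 62 (1989) 1201, proof of Theorem 1 (`N_σ` on the sectors). [cite: LiebPRL1989, proof of Theorem 1]
-/

noncomputable section

namespace Literature.MathematicalPhysics.QuantumLattice

open Matrix Finset HubbardWave0 Literature.Probability.LatticeModels ThermodynamicLimit LiebThm1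
open _root_.Filter
open scoped _root_.Topology ComplexOrder BigOperators

/-! ### §1 Slopes of mixture torus limits: spin numbers, density, magnetisation, `K`-energy -/

namespace InfVolFermionState

section Slopes

variable {d : ℕ} {ω : InfVolFermionState d} {m : ℕ → ℕ} {p : ∀ L, Fin (m L) → ℝ}
  {ψ : ∀ L, Fin (m L) → Fock (Orb (FermionTorus d L))} {Ls : ℕ → ℕ}

/-- **Spin densities of a mixture torus limit are limits of the spin numbers per site**: for every mixture
torus limit `ω` along `Ls → ∞` (any weights) and `σ ∈ {↑,↓}`,
`Σ_i p_{L,i} Re⟨ψ_{L,i}, N_σ ψ_{L,i}⟩ / L^d → Re ω(n_{0σ})`, `N_σ = Σ_y n_{yσ}` (`torusAvgExpect_nAt`).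
[cite: BratteliRobinsonI1987, §4.3.1 (PDF pp. 373–375)] -/
theorem IsTorusLimitOfMixture.tendsto_sum_mul_re_expect_spinNumber_div (h : ω.IsTorusLimitOfMixture m p ψ Ls)
    (hLs : Tendsto Ls atTop atTop) (σ : Fin 2) :
    Tendsto (fun j => ∑ i, p (Ls j) i *
        ((QuantumLattice.expect (∑ y : FermionTorus d (Ls j), numberOp y σ) (ψ (Ls j) i)).re / (Ls j : ℝ) ^ d))
      atTop (𝓝 (ω.expect ({0} : Finset (Site d)) (nAt 0 (Finset.mem_singleton_self 0) σ)).re) := by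
  have hc := (Complex.continuous_re.tendsto _).comp
    (h ({0} : Finset (Site d)) (nAt 0 (Finset.mem_singleton_self 0) σ))
  refine hc.congr' ?_
  filter_upwards [hLs.eventually_ge_atTop 1] with j hj
  haveI : NeZero (Ls j) := ⟨by omega⟩
  rw [Function.comp_apply, Complex.re_sum]
  refine Finset.sum_congr rfl fun i _ => ?_
  rw [torusAvgExpect_nAt, ← Complex.ofReal_natCast, ← Complex.ofReal_pow, Complex.re_ofReal_mul,
    Complex.div_ofReal_re]

/-- **The density of a mixture torus limit is the limit of the particle number per site** (no sector
hypothesis on the components): `Σ_i p_{L,i} Re⟨ψ_{L,i}, N ψ_{L,i}⟩ / L^d → ρ(ω)`.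
[cite: BratteliRobinsonI1987, §4.3.1 (PDF pp. 373–375)] [cite: Ruelle1969, §3.4] -/
theorem IsTorusLimitOfMixture.tendsto_sum_mul_re_expect_totalNumber_div (h : ω.IsTorusLimitOfMixture m p ψ Ls)
    (hLs : Tendsto Ls atTop atTop) :
    Tendsto (fun j => ∑ i, p (Ls j) i * ((QuantumLattice.expect totalNumber (ψ (Ls j) i)).re / (Ls j : ℝ) ^ d))
      atTop (𝓝 ω.density) := by
  have h0 := h.tendsto_sum_mul_re_expect_spinNumber_div hLs 0
  have h1 := h.tendsto_sum_mul_re_expect_spinNumber_div hLs 1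
  have hρ : ω.density = (ω.expect ({0} : Finset (Site d)) (nAt 0 (Finset.mem_singleton_self 0) 0)).re +
      (ω.expect ({0} : Finset (Site d)) (nAt 0 (Finset.mem_singleton_self 0) 1)).re := by
    rw [InfVolFermionState.density, InfVolFermionState.densityAt, map_add, Complex.add_re]
  rw [hρ]
  refine (h0.add h1).congr fun j => ?_
  rw [← Finset.sum_add_distrib]
  refine Finset.sum_congr rfl fun i _ => ?_
  have hN : (totalNumber : Matrix (Finset (Orb (FermionTorus d (Ls j)))) (Finset (Orb (FermionTorus d (Ls j)))) ℂ) =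
      (∑ y : FermionTorus d (Ls j), numberOp y 0) + ∑ y : FermionTorus d (Ls j), numberOp y 1 := by
    rw [totalNumber, ← Finset.sum_add_distrib]
    exact Finset.sum_congr rfl fun y _ => Fin.sum_univ_two _
  rw [hN]
  simp only [QuantumLattice.expect, Matrix.add_mulVec, dotProduct_add, Complex.add_re]
  ring

/-- **The magnetisation density of a mixture torus limit is the limit of the spin imbalance per site**:
`Σ_i p_{L,i} Re⟨ψ_{L,i}, (N↑ − N↓) ψ_{L,i}⟩ / L^d → Re ω(n_{0↑}) − Re ω(n_{0↓})`.
[cite: BratteliRobinsonI1987, §4.3.1 (PDF pp. 373–375)] [cite: LiebPRL1989, proof of Theorem 1] -/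
theorem IsTorusLimitOfMixture.tendsto_sum_mul_re_expect_spinImbalance_div (h : ω.IsTorusLimitOfMixture m p ψ Ls)
    (hLs : Tendsto Ls atTop atTop) :
    Tendsto (fun j => ∑ i, p (Ls j) i * ((QuantumLattice.expect spinImbalance (ψ (Ls j) i)).re / (Ls j : ℝ) ^ d))
      atTop (𝓝 ((ω.expect ({0} : Finset (Site d)) (nAt 0 (Finset.mem_singleton_self 0) 0)).re -
        (ω.expect ({0} : Finset (Site d)) (nAt 0 (Finset.mem_singleton_self 0) 1)).re)) := by
  have h0 := h.tendsto_sum_mul_re_expect_spinNumber_div hLs 0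
  have h1 := h.tendsto_sum_mul_re_expect_spinNumber_div hLs 1
  refine (h0.sub h1).congr fun j => ?_
  rw [← Finset.sum_sub_distrib]
  refine Finset.sum_congr rfl fun i _ => ?_
  have hM : (spinImbalance : Matrix (Finset (Orb (FermionTorus d (Ls j)))) (Finset (Orb (FermionTorus d (Ls j)))) ℂ) =
      (∑ y : FermionTorus d (Ls j), numberOp y 0) - ∑ y : FermionTorus d (Ls j), numberOp y 1 := by
    rw [spinImbalance, Finset.sum_sub_distrib]
  rw [hM]
  simp only [QuantumLattice.expect, Matrix.sub_mulVec, dotProduct_sub, Complex.sub_re]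
  ring

end Slopes

section GCEnergy

variable {ω : InfVolFermionState 2} {m : ℕ → ℕ} {p : ∀ L, Fin (m L) → ℝ}
  {ψ : ∀ L, Fin (m L) → Fock (Orb (FermionTorus 2 L))} {Ls : ℕ → ℕ}

/-- **The `K`-energy density of a mixture torus limit**: for every coupling point `(t,t',U,μ,h)`,
`Σ_i p_{L,i} Re⟨ψ_{L,i}, K_L(t,t',U,μ,h) ψ_{L,i}⟩ / L² → e_{Φ(t,t',U)}(ω) − μ ρ(ω) − h (Re ω(n_{0↑}) − Re ω(n_{0↓}))`
(any mixture torus limit, any weights). [cite: BratteliKishimotoRobinson1978, Thm. 2] [cite: Ruelle1969, §3.4] -/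
theorem IsTorusLimitOfMixture.tendsto_sum_mul_re_expect_gcTorusHamiltonianTT'_div_sq
    (h : ω.IsTorusLimitOfMixture m p ψ Ls) (hLs : Tendsto Ls atTop atTop) (t t' U μ hz : ℝ) :
    Tendsto (fun j => ∑ i, p (Ls j) i *
        ((QuantumLattice.expect (gcTorusHamiltonianTT' (Ls j) t t' U μ hz) (ψ (Ls j) i)).re / (Ls j : ℝ) ^ 2))
      atTop (𝓝 (ω.meanEnergy (hubbardTTPrimeFermionInteraction t t' U) 1 - μ * ω.density -
        hz * ((ω.expect ({0} : Finset (Site 2)) (nAt 0 (Finset.mem_singleton_self 0) 0)).re -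
          (ω.expect ({0} : Finset (Site 2)) (nAt 0 (Finset.mem_singleton_self 0) 1)).re))) := by
  have hE := h.tendsto_meanEnergy_hubbardTTPrime t t' U hLs
  have hN := h.tendsto_sum_mul_re_expect_totalNumber_div hLs
  have hM := h.tendsto_sum_mul_re_expect_spinImbalance_div hLs
  refine ((hE.sub (hN.const_mul μ)).sub (hM.const_mul hz)).congr fun j => ?_
  rw [Finset.mul_sum, Finset.mul_sum, ← Finset.sum_sub_distrib, ← Finset.sum_sub_distrib]
  refine Finset.sum_congr rfl fun i _ => ?_
  rw [re_expect_gcTorusHamiltonianTT']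
  ring

end GCEnergy

/-! ### §2 Thermal grand-canonical states: the tangent plane, the Griffiths brackets, the windows -/

section ThermalStates

variable {β : ℝ} (hβ : 0 ≤ β) (t t' : ℝ) {U : ℝ} (hU : 0 ≤ U) (μ hz : ℝ)
  {ω : InfVolFermionState 2} {Ls : ℕ → ℕ}
include hβ hU

/-- **THE JOINT TEMPERATURE × COUPLING TANGENT PLANE FOR THERMAL GRAND-CANONICAL STATES.** Let `ω` be a
torus limit, along `Ls → ∞`, of the grand-canonical Gibbs states `e^{−βK_L}/tr e^{−βK_L}` of
`K_L = K_L(t,t',U,μ,h)` (`β ≥ 0`, `U ≥ 0`), and write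
`u_{x₁}(ω) = e_{Φ(t₁,t'₁,U₁)}(ω) − μ₁ρ(ω) − h₁ m(ω)` (`m(ω) = Re ω(n_{0↑}) − Re ω(n_{0↓})`) for the `K(x₁)`-energy
density of `ω` at any coupling point `x₁`. Then for every `β₁ ≥ 0` and `x₁ = (t₁,t'₁,U₁,μ₁,h₁)` with `U₁ ≥ 0`:

  `P(β; x) − [β₁ u_{x₁}(ω) − β u_x(ω)] ≤ P(β₁; x₁)`,  `P = gcPressureTT'Zeeman`

— the thermodynamic limit of the Peierls–Bogoliubov tangent at the scaled anchor (every term converges: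
`tendsto_log_partitionFn_gcTorus_div_sq_comp`, `tendsto_sum_mul_re_expect_gcTorusHamiltonianTT'_div_sq`). All
the Griffiths brackets below are coordinate instances. [cite: Lieb1973, §V (5.2)–(5.4)] [cite: Ruelle1969, §3.4]
[cite: Griffiths1964] -/
theorem IsTorusLimitOfMixture.gcPressureTT'Zeeman_sub_le_of_gcGibbs
    (hω : ω.IsTorusLimitOfMixture sourcedGibbsCount (gcGibbsWeightTT' β t t' U μ hz)
      (gcGibbsVectorTT' t t' U μ hz) Ls)
    (hLs : Tendsto Ls atTop atTop) {β₁ : ℝ} (hβ₁ : 0 ≤ β₁) (t₁ t'₁ : ℝ) {U₁ : ℝ} (hU₁ : 0 ≤ U₁) (μ₁ h₁ : ℝ) :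
    gcPressureTT'Zeeman β t t' U μ hz -
        (β₁ * (ω.meanEnergy (hubbardTTPrimeFermionInteraction t₁ t'₁ U₁) 1 - μ₁ * ω.density -
            h₁ * ((ω.expect ({0} : Finset (Site 2)) (nAt 0 (Finset.mem_singleton_self 0) 0)).re -
              (ω.expect ({0} : Finset (Site 2)) (nAt 0 (Finset.mem_singleton_self 0) 1)).re)) -
          β * (ω.meanEnergy (hubbardTTPrimeFermionInteraction t t' U) 1 - μ * ω.density -
            hz * ((ω.expect ({0} : Finset (Site 2)) (nAt 0 (Finset.mem_singleton_self 0) 0)).re -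
              (ω.expect ({0} : Finset (Site 2)) (nAt 0 (Finset.mem_singleton_self 0) 1)).re))) ≤
      gcPressureTT'Zeeman β₁ t₁ t'₁ U₁ μ₁ h₁ := by
  have hP := tendsto_log_partitionFn_gcTorus_div_sq_comp hβ t t' hU μ hz hLs
  have hP₁ := tendsto_log_partitionFn_gcTorus_div_sq_comp hβ₁ t₁ t'₁ hU₁ μ₁ h₁ hLs
  have hA := hω.tendsto_sum_mul_re_expect_gcTorusHamiltonianTT'_div_sq hLs t t' U μ hz
  have hA₁ := hω.tendsto_sum_mul_re_expect_gcTorusHamiltonianTT'_div_sq hLs t₁ t'₁ U₁ μ₁ h₁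
  refine le_of_tendsto_of_tendsto (hP.sub ((hA₁.const_mul β₁).sub (hA.const_mul β))) hP₁ ?_
  filter_upwards [hLs.eventually_ge_atTop 1] with j hj
  have hL2 : (0 : ℝ) < ((Ls j : ℕ) : ℝ) ^ 2 := by
    have : (1 : ℝ) ≤ ((Ls j : ℕ) : ℝ) := by exact_mod_cast hj
    positivity
  have hfin := log_partitionFn_gcTorus_ge_tangent_mixture β t t' U μ hz (Ls j) β₁ t₁ t'₁ U₁ μ₁ h₁
  rw [Finset.mul_sum, Finset.mul_sum]
  have e1 : ∑ i, β₁ * (gcGibbsWeightTT' β t t' U μ hz (Ls j) i *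
      ((QuantumLattice.expect (gcTorusHamiltonianTT' (Ls j) t₁ t'₁ U₁ μ₁ h₁) (gcGibbsVectorTT' t t' U μ hz (Ls j) i)).re /
        ((Ls j : ℕ) : ℝ) ^ 2)) =
      (β₁ * ∑ i, gcGibbsWeightTT' β t t' U μ hz (Ls j) i *
        (QuantumLattice.expect (gcTorusHamiltonianTT' (Ls j) t₁ t'₁ U₁ μ₁ h₁) (gcGibbsVectorTT' t t' U μ hz (Ls j) i)).re) /
          ((Ls j : ℕ) : ℝ) ^ 2 := by
    rw [Finset.mul_sum, Finset.sum_div]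
    exact Finset.sum_congr rfl fun i _ => by ring
  have e2 : ∑ i, β * (gcGibbsWeightTT' β t t' U μ hz (Ls j) i *
      ((QuantumLattice.expect (gcTorusHamiltonianTT' (Ls j) t t' U μ hz) (gcGibbsVectorTT' t t' U μ hz (Ls j) i)).re /
        ((Ls j : ℕ) : ℝ) ^ 2)) =
      (β * ∑ i, gcGibbsWeightTT' β t t' U μ hz (Ls j) i *
        (QuantumLattice.expect (gcTorusHamiltonianTT' (Ls j) t t' U μ hz) (gcGibbsVectorTT' t t' U μ hz (Ls j) i)).re) /
          ((Ls j : ℕ) : ℝ) ^ 2 := by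
    rw [Finset.mul_sum, Finset.sum_div]
    exact Finset.sum_congr rfl fun i _ => by ring
  rw [e1, e2, ← sub_div, ← sub_div, div_le_div_iff_of_pos_right hL2]
  exact hfin

/-! #### Coordinate instances: the Griffiths brackets for the state's density, magnetisation, double
occupancy, hopping energies and thermal energy -/

/-- **Density is a subgradient of the pressure in the chemical potential**: for every `μ₁`,
`β ρ(ω) (μ₁ − μ) ≤ P(μ₁) − P(μ)` (all other couplings and `β` fixed). [cite: Griffiths1964] [cite: Ruelle1969, §3.4] -/
theorem IsTorusLimitOfMixture.mul_density_mul_sub_le_gcPressureTT'Zeeman_sub_of_gcGibbs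
    (hω : ω.IsTorusLimitOfMixture sourcedGibbsCount (gcGibbsWeightTT' β t t' U μ hz)
      (gcGibbsVectorTT' t t' U μ hz) Ls)
    (hLs : Tendsto Ls atTop atTop) (μ₁ : ℝ) :
    β * ω.density * (μ₁ - μ) ≤ gcPressureTT'Zeeman β t t' U μ₁ hz - gcPressureTT'Zeeman β t t' U μ hz := by
  have h := hω.gcPressureTT'Zeeman_sub_le_of_gcGibbs hβ t t' hU μ hz hLs hβ t t' hU μ₁ hz
  calc β * ω.density * (μ₁ - μ)
      = -(β * (ω.meanEnergy (hubbardTTPrimeFermionInteraction t t' U) 1 - μ₁ * ω.density -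
            hz * ((ω.expect ({0} : Finset (Site 2)) (nAt 0 (Finset.mem_singleton_self 0) 0)).re -
              (ω.expect ({0} : Finset (Site 2)) (nAt 0 (Finset.mem_singleton_self 0) 1)).re)) -
          β * (ω.meanEnergy (hubbardTTPrimeFermionInteraction t t' U) 1 - μ * ω.density -
            hz * ((ω.expect ({0} : Finset (Site 2)) (nAt 0 (Finset.mem_singleton_self 0) 0)).re -
              (ω.expect ({0} : Finset (Site 2)) (nAt 0 (Finset.mem_singleton_self 0) 1)).re))) := by ring
    _ ≤ _ := by linarith

/-- **Magnetisation is a subgradient of the pressure in the field**: for every `h₁`,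
`β m(ω) (h₁ − h) ≤ P(h₁) − P(h)`, `m(ω) = Re ω(n_{0↑}) − Re ω(n_{0↓})`. [cite: Griffiths1964] [cite: Ruelle1969, §3.4] -/
theorem IsTorusLimitOfMixture.mul_magnetisation_mul_sub_le_gcPressureTT'Zeeman_sub_of_gcGibbs
    (hω : ω.IsTorusLimitOfMixture sourcedGibbsCount (gcGibbsWeightTT' β t t' U μ hz)
      (gcGibbsVectorTT' t t' U μ hz) Ls)
    (hLs : Tendsto Ls atTop atTop) (h₁ : ℝ) :
    β * ((ω.expect ({0} : Finset (Site 2)) (nAt 0 (Finset.mem_singleton_self 0) 0)).re -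
          (ω.expect ({0} : Finset (Site 2)) (nAt 0 (Finset.mem_singleton_self 0) 1)).re) * (h₁ - hz) ≤
      gcPressureTT'Zeeman β t t' U μ h₁ - gcPressureTT'Zeeman β t t' U μ hz := by
  have h := hω.gcPressureTT'Zeeman_sub_le_of_gcGibbs hβ t t' hU μ hz hLs hβ t t' hU μ h₁
  calc β * ((ω.expect ({0} : Finset (Site 2)) (nAt 0 (Finset.mem_singleton_self 0) 0)).re -
          (ω.expect ({0} : Finset (Site 2)) (nAt 0 (Finset.mem_singleton_self 0) 1)).re) * (h₁ - hz)
      = -(β * (ω.meanEnergy (hubbardTTPrimeFermionInteraction t t' U) 1 - μ * ω.density -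
            h₁ * ((ω.expect ({0} : Finset (Site 2)) (nAt 0 (Finset.mem_singleton_self 0) 0)).re -
              (ω.expect ({0} : Finset (Site 2)) (nAt 0 (Finset.mem_singleton_self 0) 1)).re)) -
          β * (ω.meanEnergy (hubbardTTPrimeFermionInteraction t t' U) 1 - μ * ω.density -
            hz * ((ω.expect ({0} : Finset (Site 2)) (nAt 0 (Finset.mem_singleton_self 0) 0)).re -
              (ω.expect ({0} : Finset (Site 2)) (nAt 0 (Finset.mem_singleton_self 0) 1)).re))) := by ring
    _ ≤ _ := by linarith

/-- **Double occupancy is a supergradient of the pressure in `U`**: for every `U₁ ≥ 0`,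
`−β D(ω) (U₁ − U) ≤ P(U₁) − P(U)`, `D(ω) = Re ω(n_{0↑}n_{0↓})`. [cite: Griffiths1964] [cite: KomaTasaki1994, §1] -/
theorem IsTorusLimitOfMixture.neg_mul_docc_mul_sub_le_gcPressureTT'Zeeman_sub_of_gcGibbs
    (hω : ω.IsTorusLimitOfMixture sourcedGibbsCount (gcGibbsWeightTT' β t t' U μ hz)
      (gcGibbsVectorTT' t t' U μ hz) Ls)
    (hLs : Tendsto Ls atTop atTop) {U₁ : ℝ} (hU₁ : 0 ≤ U₁) :
    -(β * (ω.expect ({0} : Finset (Site 2))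
        (nAt 0 (Finset.mem_singleton_self 0) 0 * nAt 0 (Finset.mem_singleton_self 0) 1)).re * (U₁ - U)) ≤
      gcPressureTT'Zeeman β t t' U₁ μ hz - gcPressureTT'Zeeman β t t' U μ hz := by
  have h := hω.gcPressureTT'Zeeman_sub_le_of_gcGibbs hβ t t' hU μ hz hLs hβ t t' hU₁ μ hz
  rw [ω.meanEnergy_hubbardTTPrime_affine t t' U t' U₁, hω.meanEnergy_onSite_eq_re_expect_docc hLs] at h
  calc -(β * (ω.expect ({0} : Finset (Site 2))
        (nAt 0 (Finset.mem_singleton_self 0) 0 * nAt 0 (Finset.mem_singleton_self 0) 1)).re * (U₁ - U))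
      = -(β * (ω.meanEnergy (hubbardTTPrimeFermionInteraction t t' U) 1 +
            (U₁ - U) * (ω.expect ({0} : Finset (Site 2))
              (nAt 0 (Finset.mem_singleton_self 0) 0 * nAt 0 (Finset.mem_singleton_self 0) 1)).re +
            (t' - t') * ω.meanEnergy (hubbardTTPrimeFermionInteraction 0 1 0) 1 - μ * ω.density -
            hz * ((ω.expect ({0} : Finset (Site 2)) (nAt 0 (Finset.mem_singleton_self 0) 0)).re -
              (ω.expect ({0} : Finset (Site 2)) (nAt 0 (Finset.mem_singleton_self 0) 1)).re)) -
          β * (ω.meanEnergy (hubbardTTPrimeFermionInteraction t t' U) 1 - μ * ω.density -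
            hz * ((ω.expect ({0} : Finset (Site 2)) (nAt 0 (Finset.mem_singleton_self 0) 0)).re -
              (ω.expect ({0} : Finset (Site 2)) (nAt 0 (Finset.mem_singleton_self 0) 1)).re))) := by ring
    _ ≤ _ := by linarith

/-- **The diagonal-hopping energy is a supergradient of the pressure in `t'`**: for every `t'₁`,
`−β K₂(ω) (t'₁ − t') ≤ P(t'₁) − P(t')`, `K₂(ω) = e_{Φ(0,1,0)}(ω)`. [cite: Griffiths1964] [cite: KomaTasaki1994, §1] -/
theorem IsTorusLimitOfMixture.neg_mul_diagHop_mul_sub_le_gcPressureTT'Zeeman_sub_of_gcGibbs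
    (hω : ω.IsTorusLimitOfMixture sourcedGibbsCount (gcGibbsWeightTT' β t t' U μ hz)
      (gcGibbsVectorTT' t t' U μ hz) Ls)
    (hLs : Tendsto Ls atTop atTop) (t'₁ : ℝ) :
    -(β * ω.meanEnergy (hubbardTTPrimeFermionInteraction 0 1 0) 1 * (t'₁ - t')) ≤
      gcPressureTT'Zeeman β t t'₁ U μ hz - gcPressureTT'Zeeman β t t' U μ hz := by
  have h := hω.gcPressureTT'Zeeman_sub_le_of_gcGibbs hβ t t' hU μ hz hLs hβ t t'₁ hU μ hz
  rw [ω.meanEnergy_hubbardTTPrime_affine t t' U t'₁ U] at h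
  calc -(β * ω.meanEnergy (hubbardTTPrimeFermionInteraction 0 1 0) 1 * (t'₁ - t'))
      = -(β * (ω.meanEnergy (hubbardTTPrimeFermionInteraction t t' U) 1 +
            (U - U) * ω.meanEnergy (hubbardTTPrimeFermionInteraction 0 0 1) 1 +
            (t'₁ - t') * ω.meanEnergy (hubbardTTPrimeFermionInteraction 0 1 0) 1 - μ * ω.density -
            hz * ((ω.expect ({0} : Finset (Site 2)) (nAt 0 (Finset.mem_singleton_self 0) 0)).re -
              (ω.expect ({0} : Finset (Site 2)) (nAt 0 (Finset.mem_singleton_self 0) 1)).re)) -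
          β * (ω.meanEnergy (hubbardTTPrimeFermionInteraction t t' U) 1 - μ * ω.density -
            hz * ((ω.expect ({0} : Finset (Site 2)) (nAt 0 (Finset.mem_singleton_self 0) 0)).re -
              (ω.expect ({0} : Finset (Site 2)) (nAt 0 (Finset.mem_singleton_self 0) 1)).re))) := by ring
    _ ≤ _ := by linarith

/-- **The nearest-neighbour hopping energy is a supergradient of the pressure in `t`**: for every `t₁`,
`−β K₁(ω) (t₁ − t) ≤ P(t₁) − P(t)`, `K₁(ω) = e_{Φ(1,0,0)}(ω)`. [cite: Griffiths1964] [cite: KomaTasaki1994, §1] -/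
theorem IsTorusLimitOfMixture.neg_mul_nnHop_mul_sub_le_gcPressureTT'Zeeman_sub_of_gcGibbs
    (hω : ω.IsTorusLimitOfMixture sourcedGibbsCount (gcGibbsWeightTT' β t t' U μ hz)
      (gcGibbsVectorTT' t t' U μ hz) Ls)
    (hLs : Tendsto Ls atTop atTop) (t₁ : ℝ) :
    -(β * ω.meanEnergy (hubbardTTPrimeFermionInteraction 1 0 0) 1 * (t₁ - t)) ≤
      gcPressureTT'Zeeman β t₁ t' U μ hz - gcPressureTT'Zeeman β t t' U μ hz := by
  have h := hω.gcPressureTT'Zeeman_sub_le_of_gcGibbs hβ t t' hU μ hz hLs hβ t₁ t' hU μ hz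
  have hsplit : ω.meanEnergy (hubbardTTPrimeFermionInteraction t₁ t' U) 1 =
      ω.meanEnergy (hubbardTTPrimeFermionInteraction t t' U) 1 +
        (t₁ - t) * ω.meanEnergy (hubbardTTPrimeFermionInteraction 1 0 0) 1 := by
    have h1 := ω.meanEnergy_hubbardTTPrime_add t (t₁ - t) t' 0 U 0
    rw [add_sub_cancel, add_zero, add_zero] at h1
    have h2 := ω.meanEnergy_hubbardTTPrime_smul (t₁ - t) 1 0 0
    simp only [mul_one, mul_zero] at h2
    rw [h1, h2]
  rw [hsplit] at h
  calc -(β * ω.meanEnergy (hubbardTTPrimeFermionInteraction 1 0 0) 1 * (t₁ - t))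
      = -(β * (ω.meanEnergy (hubbardTTPrimeFermionInteraction t t' U) 1 +
            (t₁ - t) * ω.meanEnergy (hubbardTTPrimeFermionInteraction 1 0 0) 1 - μ * ω.density -
            hz * ((ω.expect ({0} : Finset (Site 2)) (nAt 0 (Finset.mem_singleton_self 0) 0)).re -
              (ω.expect ({0} : Finset (Site 2)) (nAt 0 (Finset.mem_singleton_self 0) 1)).re)) -
          β * (ω.meanEnergy (hubbardTTPrimeFermionInteraction t t' U) 1 - μ * ω.density -
            hz * ((ω.expect ({0} : Finset (Site 2)) (nAt 0 (Finset.mem_singleton_self 0) 0)).re -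
              (ω.expect ({0} : Finset (Site 2)) (nAt 0 (Finset.mem_singleton_self 0) 1)).re))) := by ring
    _ ≤ _ := by linarith

/-- **The thermal energy is a supergradient of the pressure in `−β`** (convexity in the temperature axis):
for every `β₁ ≥ 0`, `P(β) − P(β₁) ≤ (β₁ − β) u(ω)` with
`u(ω) = e_{Φ(t,t',U)}(ω) − μρ(ω) − h m(ω)` the `K`-energy density of `ω`. [cite: Griffiths1964] [cite: Israel1979, Thm. I.3.4] -/
theorem IsTorusLimitOfMixture.gcPressureTT'Zeeman_sub_le_sub_mul_energy_of_gcGibbs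
    (hω : ω.IsTorusLimitOfMixture sourcedGibbsCount (gcGibbsWeightTT' β t t' U μ hz)
      (gcGibbsVectorTT' t t' U μ hz) Ls)
    (hLs : Tendsto Ls atTop atTop) {β₁ : ℝ} (hβ₁ : 0 ≤ β₁) :
    gcPressureTT'Zeeman β t t' U μ hz - gcPressureTT'Zeeman β₁ t t' U μ hz ≤
      (β₁ - β) * (ω.meanEnergy (hubbardTTPrimeFermionInteraction t t' U) 1 - μ * ω.density -
        hz * ((ω.expect ({0} : Finset (Site 2)) (nAt 0 (Finset.mem_singleton_self 0) 0)).re -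
          (ω.expect ({0} : Finset (Site 2)) (nAt 0 (Finset.mem_singleton_self 0) 1)).re)) := by
  have h := hω.gcPressureTT'Zeeman_sub_le_of_gcGibbs hβ t t' hU μ hz hLs hβ₁ t t' hU μ hz
  linarith

/-! #### Certificate forms: three certified grand-canonical pressures bracket each observable of the state -/

/-- **DENSITY WINDOW of a thermal grand-canonical state from three pressures** (`β > 0`, `δ > 0`): a floor
`W ≤ P(μ)` and ceilings `P(μ+δ) ≤ q₊`, `P(μ−δ) ≤ q₋` give `(W − q₋)/(βδ) ≤ ρ(ω) ≤ (q₊ − W)/(βδ)`.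
[cite: Griffiths1964] [cite: Ruelle1969, §3.4] -/
theorem IsTorusLimitOfMixture.density_mem_Icc_of_gc_bounds_of_gcGibbs
    (hω : ω.IsTorusLimitOfMixture sourcedGibbsCount (gcGibbsWeightTT' β t t' U μ hz)
      (gcGibbsVectorTT' t t' U μ hz) Ls)
    (hLs : Tendsto Ls atTop atTop) (hβ' : 0 < β) {δ W qlo qhi : ℝ} (hδ : 0 < δ)
    (hW : W ≤ gcPressureTT'Zeeman β t t' U μ hz) (hqhi : gcPressureTT'Zeeman β t t' U (μ + δ) hz ≤ qhi)
    (hqlo : gcPressureTT'Zeeman β t t' U (μ - δ) hz ≤ qlo) :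
    ω.density ∈ Set.Icc ((W - qlo) / (β * δ)) ((qhi - W) / (β * δ)) := by
  have hβδ : 0 < β * δ := mul_pos hβ' hδ
  have hup := hω.mul_density_mul_sub_le_gcPressureTT'Zeeman_sub_of_gcGibbs hβ t t' hU μ hz hLs (μ + δ)
  have hdn := hω.mul_density_mul_sub_le_gcPressureTT'Zeeman_sub_of_gcGibbs hβ t t' hU μ hz hLs (μ - δ)
  rw [add_sub_cancel_left] at hup
  rw [sub_sub_cancel_left] at hdn
  constructor
  · rw [div_le_iff₀ hβδ]; nlinarith
  · rw [le_div_iff₀ hβδ]; nlinarith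

/-- **MAGNETISATION WINDOW from three pressures in the field** (`β > 0`, `δ > 0`): `W ≤ P(h)`, `P(h+δ) ≤ q₊`,
`P(h−δ) ≤ q₋` give `(W − q₋)/(βδ) ≤ m(ω) ≤ (q₊ − W)/(βδ)`. [cite: Griffiths1964] [cite: Ruelle1969, §3.4] -/
theorem IsTorusLimitOfMixture.magnetisation_mem_Icc_of_gc_bounds_of_gcGibbs
    (hω : ω.IsTorusLimitOfMixture sourcedGibbsCount (gcGibbsWeightTT' β t t' U μ hz)
      (gcGibbsVectorTT' t t' U μ hz) Ls)
    (hLs : Tendsto Ls atTop atTop) (hβ' : 0 < β) {δ W qlo qhi : ℝ} (hδ : 0 < δ)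
    (hW : W ≤ gcPressureTT'Zeeman β t t' U μ hz) (hqhi : gcPressureTT'Zeeman β t t' U μ (hz + δ) ≤ qhi)
    (hqlo : gcPressureTT'Zeeman β t t' U μ (hz - δ) ≤ qlo) :
    (ω.expect ({0} : Finset (Site 2)) (nAt 0 (Finset.mem_singleton_self 0) 0)).re -
        (ω.expect ({0} : Finset (Site 2)) (nAt 0 (Finset.mem_singleton_self 0) 1)).re ∈
      Set.Icc ((W - qlo) / (β * δ)) ((qhi - W) / (β * δ)) := by
  have hβδ : 0 < β * δ := mul_pos hβ' hδ
  have hup := hω.mul_magnetisation_mul_sub_le_gcPressureTT'Zeeman_sub_of_gcGibbs hβ t t' hU μ hz hLs (hz + δ)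
  have hdn := hω.mul_magnetisation_mul_sub_le_gcPressureTT'Zeeman_sub_of_gcGibbs hβ t t' hU μ hz hLs (hz - δ)
  rw [add_sub_cancel_left] at hup
  rw [sub_sub_cancel_left] at hdn
  constructor
  · rw [div_le_iff₀ hβδ]; nlinarith
  · rw [le_div_iff₀ hβδ]; nlinarith

/-- **DOUBLE-OCCUPANCY WINDOW from three pressures in `U`** (`β > 0`, `0 < δ ≤ U`): `W ≤ P(U)`, `P(U+δ) ≤ q₊`,
`P(U−δ) ≤ q₋` give `(W − q₊)/(βδ) ≤ D(ω) ≤ (q₋ − W)/(βδ)`. [cite: Griffiths1964] [cite: KomaTasaki1994, §1] -/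
theorem IsTorusLimitOfMixture.docc_mem_Icc_of_gc_bounds_of_gcGibbs
    (hω : ω.IsTorusLimitOfMixture sourcedGibbsCount (gcGibbsWeightTT' β t t' U μ hz)
      (gcGibbsVectorTT' t t' U μ hz) Ls)
    (hLs : Tendsto Ls atTop atTop) (hβ' : 0 < β) {δ W qlo qhi : ℝ} (hδ : 0 < δ) (hδU : δ ≤ U)
    (hW : W ≤ gcPressureTT'Zeeman β t t' U μ hz) (hqhi : gcPressureTT'Zeeman β t t' (U + δ) μ hz ≤ qhi)
    (hqlo : gcPressureTT'Zeeman β t t' (U - δ) μ hz ≤ qlo) :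
    (ω.expect ({0} : Finset (Site 2))
        (nAt 0 (Finset.mem_singleton_self 0) 0 * nAt 0 (Finset.mem_singleton_self 0) 1)).re ∈
      Set.Icc ((W - qhi) / (β * δ)) ((qlo - W) / (β * δ)) := by
  have hβδ : 0 < β * δ := mul_pos hβ' hδ
  have hup := hω.neg_mul_docc_mul_sub_le_gcPressureTT'Zeeman_sub_of_gcGibbs hβ t t' hU μ hz hLs
    (U₁ := U + δ) (by linarith)
  have hdn := hω.neg_mul_docc_mul_sub_le_gcPressureTT'Zeeman_sub_of_gcGibbs hβ t t' hU μ hz hLs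
    (U₁ := U - δ) (by linarith)
  rw [add_sub_cancel_left] at hup
  rw [sub_sub_cancel_left] at hdn
  constructor
  · rw [div_le_iff₀ hβδ]; nlinarith
  · rw [le_div_iff₀ hβδ]; nlinarith

/-- **DIAGONAL-HOPPING WINDOW from three pressures in `t'`** (`β > 0`, `δ > 0`): `W ≤ P(t')`, `P(t'+δ) ≤ q₊`,
`P(t'−δ) ≤ q₋` give `(W − q₊)/(βδ) ≤ K₂(ω) ≤ (q₋ − W)/(βδ)`. [cite: Griffiths1964] [cite: KomaTasaki1994, §1] -/
theorem IsTorusLimitOfMixture.diagHop_mem_Icc_of_gc_bounds_of_gcGibbs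
    (hω : ω.IsTorusLimitOfMixture sourcedGibbsCount (gcGibbsWeightTT' β t t' U μ hz)
      (gcGibbsVectorTT' t t' U μ hz) Ls)
    (hLs : Tendsto Ls atTop atTop) (hβ' : 0 < β) {δ W qlo qhi : ℝ} (hδ : 0 < δ)
    (hW : W ≤ gcPressureTT'Zeeman β t t' U μ hz) (hqhi : gcPressureTT'Zeeman β t (t' + δ) U μ hz ≤ qhi)
    (hqlo : gcPressureTT'Zeeman β t (t' - δ) U μ hz ≤ qlo) :
    ω.meanEnergy (hubbardTTPrimeFermionInteraction 0 1 0) 1 ∈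
      Set.Icc ((W - qhi) / (β * δ)) ((qlo - W) / (β * δ)) := by
  have hβδ : 0 < β * δ := mul_pos hβ' hδ
  have hup := hω.neg_mul_diagHop_mul_sub_le_gcPressureTT'Zeeman_sub_of_gcGibbs hβ t t' hU μ hz hLs (t' + δ)
  have hdn := hω.neg_mul_diagHop_mul_sub_le_gcPressureTT'Zeeman_sub_of_gcGibbs hβ t t' hU μ hz hLs (t' - δ)
  rw [add_sub_cancel_left] at hup
  rw [sub_sub_cancel_left] at hdn
  constructor
  · rw [div_le_iff₀ hβδ]; nlinarith
  · rw [le_div_iff₀ hβδ]; nlinarith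

/-- **THERMAL ENERGY WINDOW from three pressures in the temperature** (`0 < δ ≤ β`): `W ≤ P(β)`,
`P(β+δ) ≤ q₊`, `P(β−δ) ≤ q₋` give `(W − q₊)/δ ≤ u(ω) ≤ (q₋ − W)/δ` for the `K`-energy density
`u(ω) = e_{Φ(t,t',U)}(ω) − μρ(ω) − h m(ω)`. [cite: Griffiths1964] [cite: Israel1979, Thm. I.3.4] -/
theorem IsTorusLimitOfMixture.energy_mem_Icc_of_gc_bounds_of_gcGibbs
    (hω : ω.IsTorusLimitOfMixture sourcedGibbsCount (gcGibbsWeightTT' β t t' U μ hz)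
      (gcGibbsVectorTT' t t' U μ hz) Ls)
    (hLs : Tendsto Ls atTop atTop) {δ W qlo qhi : ℝ} (hδ : 0 < δ) (hδβ : δ ≤ β)
    (hW : W ≤ gcPressureTT'Zeeman β t t' U μ hz) (hqhi : gcPressureTT'Zeeman (β + δ) t t' U μ hz ≤ qhi)
    (hqlo : gcPressureTT'Zeeman (β - δ) t t' U μ hz ≤ qlo) :
    ω.meanEnergy (hubbardTTPrimeFermionInteraction t t' U) 1 - μ * ω.density -
        hz * ((ω.expect ({0} : Finset (Site 2)) (nAt 0 (Finset.mem_singleton_self 0) 0)).re -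
          (ω.expect ({0} : Finset (Site 2)) (nAt 0 (Finset.mem_singleton_self 0) 1)).re) ∈
      Set.Icc ((W - qhi) / δ) ((qlo - W) / δ) := by
  have hup := hω.gcPressureTT'Zeeman_sub_le_sub_mul_energy_of_gcGibbs hβ t t' hU μ hz hLs
    (β₁ := β + δ) (by linarith)
  have hdn := hω.gcPressureTT'Zeeman_sub_le_sub_mul_energy_of_gcGibbs hβ t t' hU μ hz hLs
    (β₁ := β - δ) (by linarith)
  rw [add_sub_cancel_left] at hup
  rw [sub_sub_cancel_left] at hdn
  constructor
  · rw [div_le_iff₀ hδ]; nlinarith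
  · rw [le_div_iff₀ hδ]; nlinarith

/-! #### The energy–entropy window of the thermal states -/

omit hβ hU in
/-- `Σ_i w_i (E_i / c) = (Σ_i w_i E_i) / c`. [folklore] -/
private theorem sum_mul_div_eq_sum_mul_div {ι : Type*} (s : Finset ι) (w E : ι → ℝ) (c : ℝ) :
    ∑ i ∈ s, w i * (E i / c) = (∑ i ∈ s, w i * E i) / c := by
  rw [Finset.sum_div]
  exact Finset.sum_congr rfl fun i _ => (mul_div_assoc _ _ _).symm

omit hβ hU in
/-- **Variational floor in finite volume**: the mixture energy is at least the ground-state energy,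
`E₀(K_L) ≤ Σ_i p_{L,i} Re⟨ψ_{L,i}, K_L ψ_{L,i}⟩` (every component is a unit vector, the weights are a
probability vector). [cite: Tasaki2020, §2.1] -/
theorem groundEnergy_le_sum_gcGibbsWeightTT'_mul_re_expect (L : ℕ) :
    (gcTorusHamiltonianTT' L t t' U μ hz).groundEnergy ≤
      ∑ i, gcGibbsWeightTT' β t t' U μ hz L i *
        (QuantumLattice.expect (gcTorusHamiltonianTT' L t t' U μ hz) (gcGibbsVectorTT' t t' U μ hz L i)).re := by
  have hK := gcTorusHamiltonianTT'_isHermitian L t t' U μ hz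
  calc (gcTorusHamiltonianTT' L t t' U μ hz).groundEnergy
      = ∑ i, gcGibbsWeightTT' β t t' U μ hz L i * (gcTorusHamiltonianTT' L t t' U μ hz).groundEnergy := by
        rw [← Finset.sum_mul, sum_gcGibbsWeightTT', one_mul]
    _ ≤ _ := Finset.sum_le_sum fun i _ => mul_le_mul_of_nonneg_left
        (groundEnergy_le_rayleigh_holds hK _ (star_gcGibbsVectorTT'_dotProduct_self t t' U μ hz L i))
        (gcGibbsWeightTT'_nonneg β t t' U μ hz L i)

omit hβ hU in
/-- **The `K`-energy density of a thermal grand-canonical state is capped by any eventual cap of the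
grand-canonical ground-state energies plus `(log 4)/β`** (`β > 0`): if `E₀(K_{Ls j}) ≤ c (Ls j)²` for all
large `j`, then `u(ω) ≤ c + (log 4)/β`. [cite: Israel1979, Lemma II.3.1] [cite: Ruelle1969, §3.4] -/
theorem IsTorusLimitOfMixture.energy_le_of_groundEnergy_le_of_gcGibbs
    (hω : ω.IsTorusLimitOfMixture sourcedGibbsCount (gcGibbsWeightTT' β t t' U μ hz)
      (gcGibbsVectorTT' t t' U μ hz) Ls)
    (hLs : Tendsto Ls atTop atTop) (hβ' : 0 < β) {c : ℝ}
    (hc : ∀ᶠ j in atTop, (gcTorusHamiltonianTT' (Ls j) t t' U μ hz).groundEnergy ≤ c * ((Ls j : ℕ) : ℝ) ^ 2) :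
    ω.meanEnergy (hubbardTTPrimeFermionInteraction t t' U) 1 - μ * ω.density -
        hz * ((ω.expect ({0} : Finset (Site 2)) (nAt 0 (Finset.mem_singleton_self 0) 0)).re -
          (ω.expect ({0} : Finset (Site 2)) (nAt 0 (Finset.mem_singleton_self 0) 1)).re) ≤
      c + Real.log 4 / β := by
  have hA := hω.tendsto_sum_mul_re_expect_gcTorusHamiltonianTT'_div_sq hLs t t' U μ hz
  refine le_of_tendsto hA ?_
  filter_upwards [hc, hLs.eventually_ge_atTop 1] with j hj hj1
  have hL2 : (0 : ℝ) < ((Ls j : ℕ) : ℝ) ^ 2 := by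
    have : (1 : ℝ) ≤ ((Ls j : ℕ) : ℝ) := by exact_mod_cast hj1
    positivity
  have hcap := sum_gcGibbsWeightTT'_mul_re_expect_le_log_four β t t' U μ hz (Ls j) hβ'
  rw [sum_mul_div_eq_sum_mul_div, div_le_iff₀ hL2]
  have e : (c + Real.log 4 / β) * ((Ls j : ℕ) : ℝ) ^ 2 = c * ((Ls j : ℕ) : ℝ) ^ 2 +
      Real.log 4 * ((Ls j : ℕ) : ℝ) ^ 2 / β := by ring
  rw [e]
  linarith

omit hβ hU in
/-- **… and floored by any eventual floor of the grand-canonical ground-state energies** (no `β` needed): if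
`c (Ls j)² ≤ E₀(K_{Ls j})` for all large `j`, then `c ≤ u(ω)`. [cite: Tasaki2020, §2.1] [cite: Ruelle1969, §3.4] -/
theorem IsTorusLimitOfMixture.le_energy_of_le_groundEnergy_of_gcGibbs
    (hω : ω.IsTorusLimitOfMixture sourcedGibbsCount (gcGibbsWeightTT' β t t' U μ hz)
      (gcGibbsVectorTT' t t' U μ hz) Ls)
    (hLs : Tendsto Ls atTop atTop) {c : ℝ}
    (hc : ∀ᶠ j in atTop, c * ((Ls j : ℕ) : ℝ) ^ 2 ≤ (gcTorusHamiltonianTT' (Ls j) t t' U μ hz).groundEnergy) :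
    c ≤ ω.meanEnergy (hubbardTTPrimeFermionInteraction t t' U) 1 - μ * ω.density -
        hz * ((ω.expect ({0} : Finset (Site 2)) (nAt 0 (Finset.mem_singleton_self 0) 0)).re -
          (ω.expect ({0} : Finset (Site 2)) (nAt 0 (Finset.mem_singleton_self 0) 1)).re) := by
  have hA := hω.tendsto_sum_mul_re_expect_gcTorusHamiltonianTT'_div_sq hLs t t' U μ hz
  refine ge_of_tendsto hA ?_
  filter_upwards [hc, hLs.eventually_ge_atTop 1] with j hj hj1
  have hL2 : (0 : ℝ) < ((Ls j : ℕ) : ℝ) ^ 2 := by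
    have : (1 : ℝ) ≤ ((Ls j : ℕ) : ℝ) := by exact_mod_cast hj1
    positivity
  have hfloor := groundEnergy_le_sum_gcGibbsWeightTT'_mul_re_expect (β := β) (U := U) t t' μ hz (Ls j)
  rw [sum_mul_div_eq_sum_mul_div, le_div_iff₀ hL2]
  linarith

omit hβ in
/-- **At zero field the window is keyed to the `T = 0` grand potential**: for a torus limit `ω` of the
grand-canonical Gibbs states of `H_L − μN` (`h = 0`, `β > 0`, `U ≥ 0`),
`p₀(μ) ≤ e_{Φ(t,t',U)}(ω) − μρ(ω) ≤ p₀(μ) + (log 4)/β` with `p₀ = gcEnergyDensityTT' t t' U μ`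
(`E₀(H_L − μN)/L² → p₀(μ)`, `tendsto_groundEnergy_gc_hubbardTorusTT'_div_sq`): a certified `μ`-floor row on
`p₀` is a floor on the thermal energy, a certified cap plus `T log 4` a cap. [cite: Israel1979, Lemma II.3.1]
[cite: Ruelle1969, §3.4] -/
theorem IsTorusLimitOfMixture.energy_mem_Icc_gcEnergyDensityTT'_of_gcGibbs
    (hω : ω.IsTorusLimitOfMixture sourcedGibbsCount (gcGibbsWeightTT' β t t' U μ 0)
      (gcGibbsVectorTT' t t' U μ 0) Ls)
    (hLs : Tendsto Ls atTop atTop) (hβ' : 0 < β) :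
    ω.meanEnergy (hubbardTTPrimeFermionInteraction t t' U) 1 - μ * ω.density ∈
      Set.Icc (gcEnergyDensityTT' t t' U μ) (gcEnergyDensityTT' t t' U μ + Real.log 4 / β) := by
  have hK0 : ∀ L : ℕ, gcTorusHamiltonianTT' L t t' U μ 0 =
      hubbardTorusTT' L t t' U - (μ : ℂ) • totalNumber := fun L => by
    rw [gcTorusHamiltonianTT', Complex.ofReal_zero, zero_smul, sub_zero]
  have hlim : Tendsto (fun j => (gcTorusHamiltonianTT' (Ls j) t t' U μ 0).groundEnergy / ((Ls j : ℕ) : ℝ) ^ 2)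
      atTop (𝓝 (gcEnergyDensityTT' t t' U μ)) := by
    refine ((tendsto_groundEnergy_gc_hubbardTorusTT'_div_sq t t' hU μ).comp hLs).congr fun j => ?_
    rw [Function.comp_apply, hK0]
  have hA := hω.tendsto_sum_mul_re_expect_gcTorusHamiltonianTT'_div_sq hLs t t' U μ 0
  have hu : ω.meanEnergy (hubbardTTPrimeFermionInteraction t t' U) 1 - μ * ω.density -
      0 * ((ω.expect ({0} : Finset (Site 2)) (nAt 0 (Finset.mem_singleton_self 0) 0)).re -
        (ω.expect ({0} : Finset (Site 2)) (nAt 0 (Finset.mem_singleton_self 0) 1)).re) =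
      ω.meanEnergy (hubbardTTPrimeFermionInteraction t t' U) 1 - μ * ω.density := by ring
  rw [hu] at hA
  constructor
  · refine le_of_tendsto_of_tendsto hlim hA ?_
    filter_upwards [hLs.eventually_ge_atTop 1] with j hj1
    have hL2 : (0 : ℝ) < ((Ls j : ℕ) : ℝ) ^ 2 := by
      have : (1 : ℝ) ≤ ((Ls j : ℕ) : ℝ) := by exact_mod_cast hj1
      positivity
    rw [sum_mul_div_eq_sum_mul_div]
    exact div_le_div_of_nonneg_right (groundEnergy_le_sum_gcGibbsWeightTT'_mul_re_expect (β := β) (U := U) t t' μ 0 (Ls j)) hL2.le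
  · refine le_of_tendsto_of_tendsto hA (hlim.add_const _) ?_
    filter_upwards [hLs.eventually_ge_atTop 1] with j hj1
    have hL2 : (0 : ℝ) < ((Ls j : ℕ) : ℝ) ^ 2 := by
      have : (1 : ℝ) ≤ ((Ls j : ℕ) : ℝ) := by exact_mod_cast hj1
      positivity
    have hcap := sum_gcGibbsWeightTT'_mul_re_expect_le_log_four β t t' U μ 0 (Ls j) hβ'
    rw [sum_mul_div_eq_sum_mul_div, div_le_iff₀ hL2]
    have e : ((gcTorusHamiltonianTT' (Ls j) t t' U μ 0).groundEnergy / ((Ls j : ℕ) : ℝ) ^ 2 + Real.log 4 / β) *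
        ((Ls j : ℕ) : ℝ) ^ 2 = (gcTorusHamiltonianTT' (Ls j) t t' U μ 0).groundEnergy +
          Real.log 4 * ((Ls j : ℕ) : ℝ) ^ 2 / β := by
      field_simp
    rw [e]
    exact hcap

end ThermalStates

end InfVolFermionState


end Literature.MathematicalPhysics.QuantumLattice

end
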